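import Mathlib

/-!
# Crux `ExactCertificate` (stmt-AtomisticToContinuum-11959), line `closure-makes-nogap-exact`,
# skeleton VIII (`InvisibilityDichotomy`), wave 2 (every dimension): stub `stub_fourierRadialDim`

Support file for the crux `ThreeConeCertificate.ExactCertificate`, skeleton VIII
(`Cruxes.ExactCertificate.Invisibility`).  Wave 1 proved that no nonzero finite-range continuous
radial kernel on `ℝ³` has Fourier transform vanishing on a lattice plane minus `0`; wave 2 lifts
this to every dimension `d`.  This file is the dimension-free version of the landed
`stub_fourierRadial` (`d = 3`): the Fourier transform of a RADIAL function `v ↦ α ‖v‖` on `ℝᵈ`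
is radial, i.e. `𝓕 (α ∘ ‖·‖) ξ` depends on `ξ` only through `‖ξ‖`.

Proof: for `‖ξ‖ = ‖η‖` the reflection `R` in the hyperplane `(ℝ ∙ (ξ - η))ᗮ` is a linear
isometry of `ℝᵈ` with `R ξ = η` (`Submodule.reflection_sub`).  The Fourier integral commutes
with linear isometries unconditionally, `𝓕 (f ∘ R) ξ = 𝓕 f (R ξ)`
(`Real.fourier_comp_linearIsometry`), and `(α ∘ ‖·‖) ∘ R = α ∘ ‖·‖` since `R` preserves norms
(`LinearIsometryEquiv.norm_map`).  Hence `𝓕 f ξ = 𝓕 (f ∘ R) ξ = 𝓕 f (R ξ) = 𝓕 f η`.  No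
integrability hypothesis is needed, and the argument is uniform in `d` (for `d = 0` the space is
trivial and `ξ = η` anyway, but no case split is required).  Pure Mathlib; no helper lemmas, no
named facts.  All `[folklore]`.
-/

noncomputable section

namespace Summit.AtomisticToContinuum.Crystallization.Theorems.ThreeConeCertificateExactCertificate.Invisibility

open scoped FourierTransform RealInnerProductSpace

/-- The Fourier transform of a radial function `v ↦ α ‖v‖` on `ℝᵈ` (any `d`) is radial: if
`‖ξ‖ = ‖η‖` then `𝓕 (α ∘ ‖·‖) ξ = 𝓕 (α ∘ ‖·‖) η` (reflect in the bisector hyperplane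
`(ℝ ∙ (ξ - η))ᗮ`, which swaps `ξ` and `η`, and use that `𝓕` commutes with linear isometries).
[folklore] -/
theorem stub_fourierRadialDim : ∀ (d : ℕ) (α : ℝ → ℂ) (ξ η : EuclideanSpace ℝ (Fin d)), ‖ξ‖ = ‖η‖ →
    𝓕 (fun v : EuclideanSpace ℝ (Fin d) => α ‖v‖) ξ = 𝓕 (fun v : EuclideanSpace ℝ (Fin d) => α ‖v‖) η := by
  -- adapted from `stub_fourierRadial` (ThreeConeCertificateExactCertificateInvisibilityRadial.lean)
  intro d α ξ η hξη
  -- the reflection in the bisector hyperplane of `ξ, η` is a linear isometry swapping them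
  set R : EuclideanSpace ℝ (Fin d) ≃ₗᵢ[ℝ] EuclideanSpace ℝ (Fin d) :=
    Submodule.reflection (ℝ ∙ (ξ - η))ᗮ
  have hR : R ξ = η := Submodule.reflection_sub hξη
  -- a radial function is invariant under the isometry `R`
  have hfR : (fun v : EuclideanSpace ℝ (Fin d) => α ‖v‖) ∘ R =
      fun v : EuclideanSpace ℝ (Fin d) => α ‖v‖ :=
    funext fun v => by simp
  calc 𝓕 (fun v : EuclideanSpace ℝ (Fin d) => α ‖v‖) ξ
      = 𝓕 ((fun v : EuclideanSpace ℝ (Fin d) => α ‖v‖) ∘ R) ξ := by rw [hfR]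
    _ = 𝓕 (fun v : EuclideanSpace ℝ (Fin d) => α ‖v‖) (R ξ) :=
        Real.fourier_comp_linearIsometry R _ ξ
    _ = 𝓕 (fun v : EuclideanSpace ℝ (Fin d) => α ‖v‖) η := by rw [hR]

end Summit.AtomisticToContinuum.Crystallization.Theorems.ThreeConeCertificateExactCertificate.Invisibility
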